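import Summits.QuantumFields.YangMills.Theorems.BalabanUVNodesN15KingModelSchwingerFunctionsHafnian

/-!
# BalabanUVNodes ∕ N15 — THE KING-MODEL RUNG (PART Ͱ-f): CONVERGENCE OF ALL POLYNOMIAL MOMENTS UNDER CONVERGENCE OF THE PRECISIONS (generic), AND THE
# (4.38)-SHAPE RATE OF EVERY `n`-POINT FUNCTION OF KING's RG BLOCK-FIELD MEASURES `dμ^{(K)} → dμ^{(∞)}`:
# `|∫∏_{i<2k}ψ(p_i)dμ^{(K)} − ∫∏ψ(p_i)dμ^{(∞)}| ≤ (2k−1)!!·k·(m⁻²+a_∞⁻¹)^{k−1}·2C_diff·L^{−K}`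
# (Track A, DAG node N15 = NE2; FAN-OUT v1.1 §N15 s3 «KING-MODEL RUNG»; uses parts Ͱ-b∕Ͱ-c (Isserlis, hafnian continuity ∕ Lipschitz), Ϝ-q (`…_of_forms`), Ϝ-d,
# Ϡ-e∕Ϡ-g (`blockCov`, `C^{(∞)}`, the uniform rate); count-neutral)

HONEST FRAMING.  Count-neutral (cell `pub-ymgap`, seat `pub-ymgap-dag-n15-e` g34; `--supports stmt-QuantumFields-27366 --as helper` = K3⁸
`SpineGivenEndpointR13SepCoPHV`).  Two additions to parts Ͱ-b∕Ͱ-c.  (1) GENERIC (folklore): part Ϝ-q proved that convergence of the quadratic forms of symmetric,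
uniformly coercive precisions `A_k → A` gives convergence of the laws `ρ_{A_k}dx → ρ_Adx` in total variation, hence of all BOUNDED observables and of the
exponential moments; the POLYNOMIAL moments are unbounded observables — here they converge too, at once from Isserlis (part Ͱ-b: they are hafnians of the
Gram matrices `⟨J_u,A_k⁻¹J_v⟩`), the continuity of the hafnian in its entries (part Ͱ-c) and part Ϝ-q's `tendsto_inv_entry_of_forms`.  (2) KING ([King1986]
C. King, Commun. Math. Phys. **102** (1986) 649–677; `A = 0`, `g = 0`, odd `L ≥ 2`, `a, m² > 0`, every unit torus): part Ͱ-c gave the (4.38)-shape rate for the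
`n`-point functions of the block averages of the fine free field; this file gives the twin for King's RG block-field measures `dμ^{(K)} = ρ_{Δ^{(K)}}dψ` and their
limit `dμ^{(∞)}` (part Ϝ-v): with the UNIFORM bound `|(Δ^{(K)})⁻¹(b,b′)|, |C^{(∞)}(b,b′)| ≤ m⁻² + a_∞⁻¹` (the kernel is `S₂^{(K)} + a_K⁻¹δ` with `|S₂^{(K)}| ≤ m⁻²`,
part Ϝ-d, and `a_K ≥ a_∞`) and part Ϝ-l's volume-free rate `|(Δ^{(K)})⁻¹ − C^{(∞)}| ≤ 2C_diff·L^{−K}`, the hafnian Lipschitz estimate gives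
`|S^{RG}_{2k,K}(p) − S^{RG}_{2k,∞}(p)| ≤ (2k−1)!!·k·(m⁻²+a_∞⁻¹)^{k−1}·2C_diff·L^{−K}` for every `K ≥ 1` and every `2k` points.  NOT a node discharge (N15 is booked
through n15-a's knit, untouched here); nothing Bałaban ∕ continuum-Yang–Mills ∕ `ℝ⁴` ∕ OS ∕ mass-gap ∕ Clay.  0 `sorry`, 0 def; standard axioms.

WHAT THIS FILE PROVES (kernel).  §1 generic: `tendsto_inv_dot_mulVec_of_forms` (polarized part Ϝ-q), ★★ **`tendsto_integral_prod_dot_gaussDensity_of_forms`**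
(ALL mixed moments of linear forms converge), ★ `tendsto_integral_prod_eval_gaussDensity_of_forms` (coordinates); §2 KING: `blockCov_eq_kingS2_add_noise`
(`(Δ^{(K)})⁻¹ = S₂^{(K)} + a_K⁻¹δ`), ★ `abs_blockCov_le_inv_mass_add` (`≤ m⁻² + a_∞⁻¹`, uniform in `K ≥ 1`), ★ `abs_blockCovLim_le_inv_mass_add`,
★★★ **`abs_integral_prod_eval_blockFieldLaw_sub_lim_le`** (THE RG-SIDE RATE).

HONEST SCOPE.  King's free model only; constants of the tree (`CdiffM`, `aInf`), not optimised.  N15 untouched; counts unmoved.  Locators (use): [King1986] (2.6)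
p.652, (2.13)–(2.16) p.653, Thm 2.1 (2.22) p.654, Lemma 4.5 (4.38) p.674.
-/

noncomputable section

open scoped BigOperators
open Finset Matrix Filter Topology MeasureTheory

/-! ## §1 Generic: all polynomial moments converge under convergence of the precisions -/

namespace Summit.QuantumFields.YangMills.BalabanUVNodes.N15KingModelRung.FreeField

open Literature.MathematicalPhysics.QuantumFieldTheory.Balaban1983to89.QGQInverse (Coercive isUnit_of_coercive)
open Literature.Combinatorics.Enumerative (hafnian)
open Literature.Combinatorics.Enumerative.HafnianGeneratingFunction (subMat)

section Forms

variable {ι : Type*} [Fintype ι] [DecidableEq ι]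
variable {A : ℕ → Matrix ι ι ℝ} {Alim : Matrix ι ι ℝ} {δ : ℝ} {W : Type*} [DecidableEq W] [LinearOrder W]

omit [LinearOrder W] [DecidableEq W] in
/-- Polarized part Ϝ-q: `⟨J, A_k⁻¹J′⟩ → ⟨J, A⁻¹J′⟩`. [folklore] -/
theorem tendsto_inv_dot_mulVec_of_forms (hδ : 0 < δ) (hcolim : Coercive Alim δ) (hsymm : ∀ k, (A k)ᵀ = A k) (hsymmlim : Alimᵀ = Alim)
    (hlim : ∀ x, Tendsto (fun k => x ⬝ᵥ (A k *ᵥ x)) atTop (𝓝 (x ⬝ᵥ (Alim *ᵥ x)))) (J J' : ι → ℝ) :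
    Tendsto (fun k => J ⬝ᵥ ((A k)⁻¹ *ᵥ J')) atTop (𝓝 (J ⬝ᵥ (Alim⁻¹ *ᵥ J'))) := by
  simp only [dotProduct, Matrix.mulVec]
  refine tendsto_finsetSum _ fun i _ => ?_
  refine (tendsto_finsetSum _ fun j _ => ?_).const_mul _
  exact (tendsto_inv_entry_of_forms hδ hcolim hsymm hsymmlim hlim i j).mul_const _

/-- ★★ **ALL MIXED MOMENTS CONVERGE**: for symmetric precisions `A_k`, `A`, coercive with a common `δ > 0`, whose forms converge pointwise,
`∫∏_{i∈S}⟨J_i,x⟩ρ_{A_k}(x)dx → ∫∏_{i∈S}⟨J_i,x⟩ρ_A(x)dx` — the moments are the hafnians of the Gram matrices `⟨J_u,A_k⁻¹J_v⟩` (part Ͱ-b), which converge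
entrywise (part Ϝ-q), and the hafnian is continuous (part Ͱ-c). [folklore] -/
theorem tendsto_integral_prod_dot_gaussDensity_of_forms (hδ : 0 < δ) (hco : ∀ k, Coercive (A k) δ) (hcolim : Coercive Alim δ)
    (hsymm : ∀ k, (A k)ᵀ = A k) (hsymmlim : Alimᵀ = Alim)
    (hlim : ∀ x, Tendsto (fun k => x ⬝ᵥ (A k *ᵥ x)) atTop (𝓝 (x ⬝ᵥ (Alim *ᵥ x)))) (J : W → ι → ℝ) (S : Finset W) :
    Tendsto (fun k => ∫ x : ι → ℝ, (∏ i ∈ S, J i ⬝ᵥ x) * gaussDensity (A k) x) atTop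
      (𝓝 (∫ x : ι → ℝ, (∏ i ∈ S, J i ⬝ᵥ x) * gaussDensity Alim x)) := by
  have e : (fun k => ∫ x : ι → ℝ, (∏ i ∈ S, J i ⬝ᵥ x) * gaussDensity (A k) x)
      = fun k => hafnian (subMat (Matrix.of fun u v : W => J u ⬝ᵥ ((A k)⁻¹ *ᵥ J v)) S) :=
    funext fun k => integral_prod_dot_gaussDensity_eq_hafnian hδ (hco k) (hsymm k) J S
  rw [e, integral_prod_dot_gaussDensity_eq_hafnian hδ hcolim hsymmlim J S]
  exact tendsto_hafnian_of_entries fun u v => tendsto_inv_dot_mulVec_of_forms hδ hcolim hsymm hsymmlim hlim (J u) (J v)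

/-- ★ Coordinates: `∫∏_{i∈S}x_{p(i)}ρ_{A_k} → ∫∏_{i∈S}x_{p(i)}ρ_A`. [folklore] -/
theorem tendsto_integral_prod_eval_gaussDensity_of_forms (hδ : 0 < δ) (hco : ∀ k, Coercive (A k) δ) (hcolim : Coercive Alim δ)
    (hsymm : ∀ k, (A k)ᵀ = A k) (hsymmlim : Alimᵀ = Alim)
    (hlim : ∀ x, Tendsto (fun k => x ⬝ᵥ (A k *ᵥ x)) atTop (𝓝 (x ⬝ᵥ (Alim *ᵥ x)))) (p : W → ι) (S : Finset W) :
    Tendsto (fun k => ∫ x : ι → ℝ, (∏ i ∈ S, x (p i)) * gaussDensity (A k) x) atTop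
      (𝓝 (∫ x : ι → ℝ, (∏ i ∈ S, x (p i)) * gaussDensity Alim x)) := by
  have h := tendsto_integral_prod_dot_gaussDensity_of_forms hδ hco hcolim hsymm hsymmlim hlim (fun i => Pi.single (p i) (1 : ℝ)) S
  simp only [single_one_dotProduct] at h
  exact h

end Forms

end Summit.QuantumFields.YangMills.BalabanUVNodes.N15KingModelRung.FreeField

/-! ## §2 KING: the uniform bound on `(Δ^{(K)})⁻¹` and the rate of every `n`-point function of `dμ^{(K)}` -/

namespace Summit.QuantumFields.YangMills.BalabanUVNodes.N15KingModelRung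

open Literature.MathematicalPhysics.QuantumFieldTheory.Balaban1983to89.B5Prop11Plancherel (Tor)
open Literature.MathematicalPhysics.QuantumFieldTheory.Balaban1983to89.QGQInverse (Coercive isUnit_of_coercive)
open Literature.MathematicalPhysics.QuantumFieldTheory.King1986 (aK aK_pos)
open Literature.MathematicalPhysics.QuantumFieldTheory.King1986.Torus
open Literature.Combinatorics.Enumerative (hafnian)
open Literature.Combinatorics.Enumerative.HafnianGeneratingFunction (subMat)
open FreeField

section RGRate

variable {d : ℕ} (L : ℕ) (M : Fin (d + 1) → ℕ) [hM : ∀ ν, NeZero (M ν)]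
variable {W : Type*} [DecidableEq W] [LinearOrder W]

/-- `(Δ^{(K)})⁻¹(b,b′) = S₂^{(K)}(b,b′) + a_K⁻¹[b = b′]` — NE2's unit-layer kernel is the block two-point function plus the block-spin white noise (part Ϝ-d's
`kingS2_eq_effLaplacian_inv_sub` read backwards). [cite: King1986, (2.13)–(2.14) p.653] -/
theorem blockCov_eq_kingS2_add_noise (hL : 2 ≤ L) {a m2 : ℝ} (ha : 0 < a) (hm : 0 < m2) {K : ℕ} (hK : 1 ≤ K) (b b' : Tor M) :
    haveI : NeZero L := ⟨by omega⟩
    blockCov L (L ^ K) M a m2 K b b' = kingS2 (L ^ K) M m2 b b' + (aK a L K)⁻¹ * (if b = b' then 1 else 0) := by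
  haveI : NeZero L := ⟨by omega⟩
  have hL1 : (1 : ℝ) < L := by exact_mod_cast (show 1 < L by omega)
  have hLK : 1 ≤ L ^ K := Nat.one_le_pow K L (by omega)
  rw [kingS2_eq_effLaplacian_inv_sub (L ^ K) M hLK (aK_pos ha hL1 hK) hm, blockCov]
  ring

/-- ★ **THE UNIFORM BOUND ON NE2's UNIT-LAYER KERNEL**: `|(Δ^{(K)})⁻¹(b,b′)| ≤ m⁻² + a_∞⁻¹` for every `K ≥ 1` (`|S₂^{(K)}| ≤ m⁻²`, part Ϝ-d; `a_K ≥ a_∞`).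
[cite: King1986, (2.14)–(2.16) p.653, (4.33) p.674] -/
theorem abs_blockCov_le_inv_mass_add (hL : 2 ≤ L) {a m2 : ℝ} (ha : 0 < a) (hm : 0 < m2) {K : ℕ} (hK : 1 ≤ K) (b b' : Tor M) :
    haveI : NeZero L := ⟨by omega⟩
    |blockCov L (L ^ K) M a m2 K b b'| ≤ m2⁻¹ + (aInf a L)⁻¹ := by
  haveI : NeZero L := ⟨by omega⟩
  have hL1 : (1 : ℝ) < L := by exact_mod_cast (show 1 < L by omega)
  have haK := aK_pos ha hL1 hK
  have haI := aInf_pos ha hL1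
  rw [blockCov_eq_kingS2_add_noise L M hL ha hm hK b b']
  refine (abs_add_le _ _).trans (add_le_add (abs_kingS2_le (L ^ K) M hm b b') ?_)
  have h1 : |(aK a L K)⁻¹ * (if b = b' then (1 : ℝ) else 0)| ≤ (aK a L K)⁻¹ := by
    rw [abs_mul, abs_of_pos (inv_pos.mpr haK)]
    split_ifs <;> simp [haK.le]
  exact h1.trans (inv_anti₀ haI (aInf_le_aK ha hL1 hK))

/-- ★ **THE SAME FOR THE LIMIT KERNEL**: `|C^{(∞)}(b,b′)| ≤ m⁻² + a_∞⁻¹` (`C^{(∞)} = S₂^{(∞)} + a_∞⁻¹δ`, `|S₂^{(∞)}| ≤ m⁻²`).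
[cite: King1986, (2.14)–(2.16) p.653, Thm 2.1 (2.22) p.654] -/
theorem abs_blockCovLim_le_inv_mass_add (hLodd : Odd L) (hL : 2 ≤ L) {a m2 : ℝ} (ha : 0 < a) (hm : 0 < m2) (b b' : Tor M) :
    |blockCovLim L M a m2 b b'| ≤ m2⁻¹ + (aInf a L)⁻¹ := by
  have hL1 : (1 : ℝ) < L := by exact_mod_cast (show 1 < L by omega)
  have haI := aInf_pos ha hL1
  have e : blockCovLim L M a m2 b b' = kingS2Lim M m2 b b' + (aInf a L)⁻¹ * (if b = b' then 1 else 0) := by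
    rw [kingS2Lim_eq_blockCovLim_sub L M a m2 b b']
    ring
  rw [e]
  refine (abs_add_le _ _).trans (add_le_add (abs_kingS2Lim_le L M hLodd hL hm b b') ?_)
  rw [abs_mul, abs_of_pos (inv_pos.mpr haI)]
  split_ifs <;> simp [haI.le]

/-- ★★★ **THE RATE OF EVERY `n`-POINT FUNCTION OF KING's RG BLOCK-FIELD MEASURES**: for `2k` points `p : W → 𝕋_M` (`|S| = 2k`) and every `K ≥ 1`,
`|∫∏_{i∈S}ψ(p_i)dμ^{(K)} − ∫∏_{i∈S}ψ(p_i)dμ^{(∞)}| ≤ (2k−1)!!·k·(m⁻²+a_∞⁻¹)^{k−1}·2C_diff·L^{−K}` — Lemma 4.5 (4.38)'s `L^{−K}` shape for NE2's unit layer,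
propagated through Isserlis to all Schwinger functions of the block field, volume-free.
[cite: King1986, Lemma 4.5 (4.38) p.674, Thm 2.1 (2.22) p.654, Thm 3.4 (3.9) p.656] -/
theorem abs_integral_prod_eval_blockFieldLaw_sub_lim_le (hLodd : Odd L) (hL : 2 ≤ L) {a m2 : ℝ} (ha : 0 < a) (hm : 0 < m2) {K : ℕ}
    (hK : 1 ≤ K) (p : W → Tor M) {S : Finset W} {k : ℕ} (hS : S.card = 2 * k) :
    haveI : NeZero L := ⟨by omega⟩
    |(∫ ψ : Tor M → ℝ, (∏ i ∈ S, ψ (p i)) * gaussDensity (effLaplacian (L ^ K) M (aK a L K) (((L ^ K : ℕ) : ℝ) ^ 2) m2) ψ)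
        - ∫ ψ : Tor M → ℝ, (∏ i ∈ S, ψ (p i)) * gaussDensity (Matrix.of fun b b' => effLaplacianLim L M a m2 b b') ψ|
      ≤ (Nat.doubleFactorial (2 * k - 1) : ℝ)
          * (k * (m2⁻¹ + (aInf a L)⁻¹) ^ (k - 1) * (2 * CdiffM (d + 1) a m2 L * ((L : ℝ) ^ K)⁻¹)) := by
  haveI : NeZero L := ⟨by omega⟩
  have hL1 : (1 : ℝ) < L := by exact_mod_cast (show 1 < L by omega)
  have hβ : 0 ≤ m2⁻¹ + (aInf a L)⁻¹ := by
    have := aInf_pos ha hL1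
    positivity
  rw [integral_prod_eval_blockFieldLaw_eq_hafnian L M hL ha hm hK p S, integral_prod_eval_blockFieldLawLim_eq_hafnian L M hLodd hL ha hm p S]
  refine abs_hafnian_sub_hafnian_le_of_card (by rw [Fintype.card_coe, hS]) hβ (fun u v => ?_) (fun u v => ?_) (fun u v => ?_)
  · exact abs_blockCov_le_inv_mass_add L M hL ha hm hK _ _
  · exact abs_blockCovLim_le_inv_mass_add L M hLodd hL ha hm _ _
  · exact abs_blockCov_sub_lim_le_unif L M hLodd hL ha hm hK _ _

end RGRate

end Summit.QuantumFields.YangMills.BalabanUVNodes.N15KingModelRung
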